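import Summits.CriticalPhenomena.PercolationContinuityZ3.Theorems.Transplant.KNLevelsTargetChainEdge
import HarnessLib

/-!
# A chain of target steps under an auxiliary weighting, transferred to any event that dominates its conclusion
# (design (D): the ELONGATED inner routes of the face step — p3-g2's wiring trick 14:46Z: `P_W(linkIn Qt S Ft) = P_{W_S}(o ↔ Ft)` with the inner
# prism `S` wired, so Step IV's `h3` is a straight-run chain from a wired point source, "hQ0's twin"; this file is the generic bookkeeping)

builds on p205010 (kernel theorem, internal audit signed; external expert review pending) — nothing in this file uses p205010.
Lane `prim-bschramm`, seat `prim-bschramm-p2` (handed over by p3-g2 14:46Z); helper file (`--supports stmt-CriticalPhenomena-4575`).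

* **`lt_real_of_chain`** — a linked chain `s : Fin (n+1) → TStep G'` with common source `o`, kits under a weighting `W'`, true targets `T' i ⊆ (s i).T`
  with excess `≤ η ≤ δ/2`, a chain property at `(δ ↦ ε'')`, the source bound `1 - δ < P_{W'}((s 0).reachB)`, the last true target inside `Ft`, and a
  domination `P_{W'}(⋃ t ∈ Ft, o ↔ t) ≤ μ(A)` give `1 - ε'' < μ(A)` — used with `W' := restrW Qt (pinW W (wireSet S) ⊤)`, `μ := P_W`,
  `A := linkIn Qt S Ft` (p3's `hwire`), and with the straight-run tube chain `TubeAdvData.stepA` (KNCellsBoxProdZ2ChainTA).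
[cite: KozmaNitzan2024, §4 Lemma 11 (pp. 22–23), Lemma 12 (pp. 23–25), p. 20 (Step IV)]
-/

noncomputable section

open MeasureTheory ProbabilityTheory
open scoped ENNReal Classical

namespace Summit.CriticalPhenomena.PercolationContinuityZ3.Theorems

namespace Transplant

namespace KNLevels

open Literature.Probability.Percolation Literature.Probability.LatticeModels SimpleGraph

variable {V : Type*} [DecidableEq V]

/-- **A chain certificate transferred to a dominating event** (the elongated-route form of Step IV's `h3`; also the shape of `hQ0_of_chain`).
[cite: KozmaNitzan2024, §4 Lemma 12 (pp. 23–25), p. 20] -/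
theorem lt_real_of_chain (G' : SimpleGraph V) [G'.LocallyFinite] {p : unitInterval} {W' : Sym2 V → unitInterval} {o : V} {Ft : Finset V}
    {μA : ℝ} {Δ' : ℕ} {δ ε'' η : ℝ} {n : ℕ}
    (hchain : ∀ (W : Sym2 V → unitInterval) (s : Fin (n + 1) → TStep G') (T' : Fin (n + 1) → Finset V) (η : ℝ),
      (∀ i : Fin (n + 1), (s i).L.o = (s 0).L.o) →
      (∀ i : Fin n, T' (Fin.castSucc i) ⊆ (s i.succ).L.X 0) →
      (∀ i : Fin (n + 1), T' i ⊆ (s i).T) →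
      (∀ i : Fin (n + 1), (s i).KitsAt W p Δ' δ) →
      η ≤ δ / 2 →
      (∀ i : Fin (n + 1), (prodBernoulli W).real (⋃ t ∈ (s i).T \ T' i, openConn (s 0).L.o t) ≤ η) →
      1 - δ < (prodBernoulli W).real (s 0).L.reachB →
        1 - ε'' < (prodBernoulli W).real (⋃ t ∈ T' (Fin.last n), openConn (s 0).L.o t))
    (s : Fin (n + 1) → TStep G') (T' : Fin (n + 1) → Finset V) (ho : ∀ i : Fin (n + 1), (s i).L.o = o)
    (hlink : ∀ i : Fin n, T' (Fin.castSucc i) ⊆ (s i.succ).L.X 0) (hsub : ∀ i : Fin (n + 1), T' i ⊆ (s i).T)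
    (hkits : ∀ i : Fin (n + 1), (s i).KitsAt W' p Δ' δ) (hη : η ≤ δ / 2)
    (hexc : ∀ i : Fin (n + 1), (prodBernoulli W').real (⋃ t ∈ (s i).T \ T' i, openConn o t) ≤ η)
    (hsrc : 1 - δ < (prodBernoulli W').real (s 0).L.reachB) (hTn : T' (Fin.last n) ⊆ Ft)
    (hdom : (prodBernoulli W').real (⋃ t ∈ Ft, openConn o t) ≤ μA) :
    1 - ε'' < μA := by
  have ho' : ∀ i : Fin (n + 1), (s i).L.o = (s 0).L.o := fun i => by rw [ho i, ho 0]
  have hexc' : ∀ i : Fin (n + 1), (prodBernoulli W').real (⋃ t ∈ (s i).T \ T' i, openConn (s 0).L.o t) ≤ η :=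
    fun i => by rw [ho 0]; exact hexc i
  have hc := hchain _ s T' η ho' hlink hsub hkits hη hexc' hsrc
  rw [ho 0] at hc
  refine hc.trans_le (le_trans (measureReal_mono ?_ (measure_ne_top _ _)) hdom)
  intro ω hω
  simp only [Set.mem_iUnion, exists_prop] at hω ⊢
  obtain ⟨t, ht, hωt⟩ := hω
  exact ⟨t, hTn ht, hωt⟩

end KNLevels

end Transplant

end Summit.CriticalPhenomena.PercolationContinuityZ3.Theorems

end
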